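import Literature.Geometry.Lorentzian.CarterThresholdBarrierConstants
import HarnessLib

/-!
# Arithmetic of the far barrier of Carter's equation in the threshold sliver: monomial bounds for the
# affine constants with a fuzz factor `f ≥ 1`
(namespace `Literature.Geometry.Lorentzian.Kerr`.)

Pure real-variable inequalities, the sliver companion of `CarterThresholdBarrierConstants`. In
`CarterLayerTurningPointTortoise.lean` the coefficient `q = V∘ρ − ω²` is controlled on the last stretch
`[s_lo, b₂]` of the barrier by `c₁(b₂ − s) − e₁ ≤ q ≤ c₂(b₂ − s) + e₂` with the threshold slopes
`c₁ = 2ω²(r_lo + r₊)h_lo Δ_lo²/(r_b² + a²)³`, `c₂ = ω²(2(r_t + r₊) + (r_t + r₊)²/(r_lo − r₋))Δ_b²/(r_lo² + a²)³`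
and fuzzed offsets `e₁ = Δ_b F₁/(r_lo² + a²)²`, `e₂ = Δ_b F₂/(r_lo² + a²)²`. With the midpoint choice
`r_lo = r₊ + δ/2`, `r_b = r₊ + δ`, `r₊ − r₋ ≤ δ/2`, `a² ≤ r₊²`, `r₊ + δ/2 ≤ r_t`, `r_t + r₊ ≤ 3r_b` and
brackets `3 ≤ F₁ ≤ 15f`, `0 ≤ F₂ ≤ 3f` (`f ≥ 1`):

* `layerBarrier_e₁_ge`, `layerBarrier_e₁_le` — `3δ²/(4r_b⁴) ≤ e₁ ≤ 360f·δ²/r_b⁴`;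
* `layerBarrier_c₂_le` — `c₂ ≤ 3456ω²δ³/r_b⁴`;  `layerBarrier_e₂_le` — `e₂ ≤ 72f·δ²/r_b⁴`;
* `layerBarrier_ratio_bounds` — for `L = 2e₁/c₁`: `3r_b/(ω²δ²) ≤ L ≤ 92160f·r_b/(ω²δ²)`;
* `layerBarrier_eight_e₁_le` — if `368640f·r_b ≤ ω²δ³` then `8e₁ ≤ c₁δ`;
  `layerBarrier_layer_le_one` — if `2.72·10¹⁸f³ ≤ ω⁴δ³r_b` then `(c₂L + e₁ + e₂)L² ≤ 1`;
* `layerBarrier_largeness_of_margin` — both follow from `Λ′ ≤ 4ω²r_b²`, `θ₁r_b ≤ 3δ`,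
  `3.5·10¹⁰f²/θ₁³ ≤ Λ′` (`0 < θ₁ ≤ 1`, `1 ≤ f`).

(`c₁` is fuzz-free: `thresholdBarrier_c₁_ge/le` apply verbatim.) Near-extremal Kerr programme, crux
`KappaExplicitWaveDecay` (BF-stable large-`Λ` kernel bound, sliver case).

## References
* M. Dafermos, I. Rodnianski, Y. Shlapentokh-Rothman, arXiv:1402.7034 = Ann. of Math. 183 (2016),
  §§5.2.3, 6.2 (key `DafermosRodnianskiShlapentokhrothman2014`). The algebra is folklore.
-/

noncomputable section

namespace Literature.Geometry.Lorentzian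

namespace Kerr

section LayerConstants

variable {rp rm δ a ω rt F₁ F₂ f : ℝ}

/-- `e₁ ≥ 3δ²/(4r_b⁴)` when the bracket is `≥ 3`. [folklore] -/
theorem layerBarrier_e₁_ge (hrp : 0 < rp) (hd : rm < rp) (hδ : 0 < δ) (ha : a ^ 2 ≤ rp ^ 2)
    (hF₁ : 3 ≤ F₁) :
    3 * δ ^ 2 / (4 * (rp + δ) ^ 4) ≤
      (rp + δ - rp) * (rp + δ - rm) * F₁ / ((rp + δ / 2) ^ 2 + a ^ 2) ^ 2 := by
  have hrb : 0 < rp + δ := by linarith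
  have h1 : δ ^ 2 ≤ (rp + δ - rp) * (rp + δ - rm) := by nlinarith
  have h3 : ((rp + δ / 2) ^ 2 + a ^ 2) ^ 2 ≤ 4 * (rp + δ) ^ 4 := by
    have : (rp + δ / 2) ^ 2 + a ^ 2 ≤ 2 * (rp + δ) ^ 2 := by nlinarith
    calc ((rp + δ / 2) ^ 2 + a ^ 2) ^ 2 ≤ (2 * (rp + δ) ^ 2) ^ 2 :=
          pow_le_pow_left₀ (by positivity) this 2
      _ = 4 * (rp + δ) ^ 4 := by ring
  calc 3 * δ ^ 2 / (4 * (rp + δ) ^ 4) = δ ^ 2 * 3 / (4 * (rp + δ) ^ 4) := by ring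
    _ ≤ (rp + δ - rp) * (rp + δ - rm) * F₁ / ((rp + δ / 2) ^ 2 + a ^ 2) ^ 2 := by
        apply div_le_div₀ (mul_nonneg (by nlinarith) (by linarith)) _ (by positivity) h3
        exact mul_le_mul h1 hF₁ (by norm_num) (by nlinarith)

/-- `e₁ ≤ 360f·δ²/r_b⁴` when the bracket is `≤ 15f` (`Δ_b ≤ 3δ²/2`, `(r_lo² + a²)² ≥ r_b⁴/16`).
[folklore] -/
theorem layerBarrier_e₁_le (hrp : 0 < rp) (hd : rm < rp) (hδ : 0 < δ) (hdδ : rp - rm ≤ δ / 2)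
    (hf : 1 ≤ f) (hF₁0 : 0 ≤ F₁) (hF₁ : F₁ ≤ 15 * f) :
    (rp + δ - rp) * (rp + δ - rm) * F₁ / ((rp + δ / 2) ^ 2 + a ^ 2) ^ 2 ≤ 360 * f * δ ^ 2 / (rp + δ) ^ 4 := by
  have hrb : 0 < rp + δ := by linarith
  have h1 : (rp + δ - rp) * (rp + δ - rm) ≤ 3 / 2 * δ ^ 2 := by nlinarith
  have h3 : (rp + δ) ^ 4 / 16 ≤ ((rp + δ / 2) ^ 2 + a ^ 2) ^ 2 := by
    have h4 : (rp + δ) ^ 2 / 4 ≤ (rp + δ / 2) ^ 2 + a ^ 2 := by nlinarith [sq_nonneg a]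
    calc (rp + δ) ^ 4 / 16 = ((rp + δ) ^ 2 / 4) ^ 2 := by ring
      _ ≤ ((rp + δ / 2) ^ 2 + a ^ 2) ^ 2 := pow_le_pow_left₀ (by positivity) h4 2
  calc (rp + δ - rp) * (rp + δ - rm) * F₁ / ((rp + δ / 2) ^ 2 + a ^ 2) ^ 2
      ≤ 3 / 2 * δ ^ 2 * (15 * f) / ((rp + δ) ^ 4 / 16) := by
        apply div_le_div₀ (by positivity) _ (by positivity) h3
        exact mul_le_mul h1 hF₁ hF₁0 (by positivity)
    _ = 360 * f * δ ^ 2 / (rp + δ) ^ 4 := by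
        rw [div_eq_div_iff (by positivity) (by positivity)]; ring

/-- `c₂ ≤ 3456ω²δ³/r_b⁴` (the profile zero may sit slightly beyond `r_b`: `r_t + r₊ ≤ 3r_b`).
[folklore] -/
theorem layerBarrier_c₂_le (hrp : 0 < rp) (hd : rm < rp) (hδ : 0 < δ) (hdδ : rp - rm ≤ δ / 2)
    (hrt : rp < rt) (hrtb : rt + rp ≤ 3 * (rp + δ)) :
    ω ^ 2 * (2 * (rt + rp) + (rt + rp) ^ 2 / (rp + δ / 2 - rm)) *
        ((rp + δ - rp) * (rp + δ - rm)) ^ 2 / ((rp + δ / 2) ^ 2 + a ^ 2) ^ 3 ≤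
      3456 * ω ^ 2 * δ ^ 3 / (rp + δ) ^ 4 := by
  have hrb : 0 < rp + δ := by linarith
  have hD : 0 < rp + δ / 2 - rm := by linarith
  have hω2 : 0 ≤ ω ^ 2 := sq_nonneg ω
  -- the bracket
  have hB : 2 * (rt + rp) + (rt + rp) ^ 2 / (rp + δ / 2 - rm) ≤ 24 * (rp + δ) ^ 2 / δ := by
    have h1 : 2 * (rt + rp) ≤ 6 * (rp + δ) := by linarith
    have h2 : (rt + rp) ^ 2 / (rp + δ / 2 - rm) ≤ (3 * (rp + δ)) ^ 2 / (δ / 2) :=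
      div_le_div₀ (by positivity) (pow_le_pow_left₀ (by linarith) hrtb 2) (by positivity)
        (by linarith)
    have h3 : 6 * (rp + δ) ≤ 6 * (rp + δ) ^ 2 / δ := by
      rw [le_div_iff₀ hδ]; nlinarith
    have e : (3 * (rp + δ)) ^ 2 / (δ / 2) = 18 * (rp + δ) ^ 2 / δ := by
      rw [div_eq_div_iff (by positivity) (by positivity)]; ring
    rw [e] at h2
    have : 6 * (rp + δ) ^ 2 / δ + 18 * (rp + δ) ^ 2 / δ = 24 * (rp + δ) ^ 2 / δ := by ring
    linarith
  have hB0 : 0 ≤ 2 * (rt + rp) + (rt + rp) ^ 2 / (rp + δ / 2 - rm) :=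
    add_nonneg (by linarith) (div_nonneg (sq_nonneg _) hD.le)
  have hΔ : ((rp + δ - rp) * (rp + δ - rm)) ^ 2 ≤ (3 / 2 * δ ^ 2) ^ 2 :=
    pow_le_pow_left₀ (by nlinarith) (by nlinarith) 2
  have h3 : (rp + δ) ^ 6 / 64 ≤ ((rp + δ / 2) ^ 2 + a ^ 2) ^ 3 := by
    have h4 : (rp + δ) ^ 2 / 4 ≤ (rp + δ / 2) ^ 2 + a ^ 2 := by nlinarith [sq_nonneg a]
    calc (rp + δ) ^ 6 / 64 = ((rp + δ) ^ 2 / 4) ^ 3 := by ring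
      _ ≤ ((rp + δ / 2) ^ 2 + a ^ 2) ^ 3 := pow_le_pow_left₀ (by positivity) h4 3
  calc ω ^ 2 * (2 * (rt + rp) + (rt + rp) ^ 2 / (rp + δ / 2 - rm)) *
        ((rp + δ - rp) * (rp + δ - rm)) ^ 2 / ((rp + δ / 2) ^ 2 + a ^ 2) ^ 3
      ≤ ω ^ 2 * (24 * (rp + δ) ^ 2 / δ) * (3 / 2 * δ ^ 2) ^ 2 / ((rp + δ) ^ 6 / 64) := by
        apply div_le_div₀ (by positivity) _ (by positivity) h3
        exact mul_le_mul (mul_le_mul_of_nonneg_left hB hω2) hΔ (by positivity) (by positivity)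
    _ = 3456 * ω ^ 2 * δ ^ 3 / (rp + δ) ^ 4 := by
        field_simp
        ring

/-- `e₂ ≤ 72f·δ²/r_b⁴` when the bracket is `≤ 3f`. [folklore] -/
theorem layerBarrier_e₂_le (hrp : 0 < rp) (hd : rm < rp) (hδ : 0 < δ) (hdδ : rp - rm ≤ δ / 2)
    (hf : 1 ≤ f) (hF₂0 : 0 ≤ F₂) (hF₂ : F₂ ≤ 3 * f) :
    (rp + δ - rp) * (rp + δ - rm) * F₂ / ((rp + δ / 2) ^ 2 + a ^ 2) ^ 2 ≤ 72 * f * δ ^ 2 / (rp + δ) ^ 4 := by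
  have hrb : 0 < rp + δ := by linarith
  have h1 : (rp + δ - rp) * (rp + δ - rm) ≤ 3 / 2 * δ ^ 2 := by nlinarith
  have h3 : (rp + δ) ^ 4 / 16 ≤ ((rp + δ / 2) ^ 2 + a ^ 2) ^ 2 := by
    have h4 : (rp + δ) ^ 2 / 4 ≤ (rp + δ / 2) ^ 2 + a ^ 2 := by nlinarith [sq_nonneg a]
    calc (rp + δ) ^ 4 / 16 = ((rp + δ) ^ 2 / 4) ^ 2 := by ring
      _ ≤ ((rp + δ / 2) ^ 2 + a ^ 2) ^ 2 := pow_le_pow_left₀ (by positivity) h4 2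
  calc (rp + δ - rp) * (rp + δ - rm) * F₂ / ((rp + δ / 2) ^ 2 + a ^ 2) ^ 2
      ≤ 3 / 2 * δ ^ 2 * (3 * f) / ((rp + δ) ^ 4 / 16) := by
        apply div_le_div₀ (by positivity) _ (by positivity) h3
        exact mul_le_mul h1 hF₂ hF₂0 (by positivity)
    _ = 72 * f * δ ^ 2 / (rp + δ) ^ 4 := by
        rw [div_eq_div_iff (by positivity) (by positivity)]; ring

/-! ### The Airy length `L = 2e₁/c₁` and the two largeness conditions -/

/-- **Two-sided bounds for `L = 2e₁/c₁`** with fuzz: `3r_b/(ω²δ²) ≤ 2e₁/c₁ ≤ 92160f·r_b/(ω²δ²)`.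
[folklore] -/
theorem layerBarrier_ratio_bounds {c₁ e₁ rb : ℝ} (hω : ω ≠ 0) (hδ : 0 < δ) (hrb : 0 < rb) (hf : 1 ≤ f)
    (hc₁ : ω ^ 2 * δ ^ 4 / (128 * rb ^ 5) ≤ c₁) (hc₁' : c₁ ≤ ω ^ 2 * δ ^ 4 / (2 * rb ^ 5))
    (he₁ : 3 * δ ^ 2 / (4 * rb ^ 4) ≤ e₁) (he₁' : e₁ ≤ 360 * f * δ ^ 2 / rb ^ 4) :
    3 * rb / (ω ^ 2 * δ ^ 2) ≤ 2 * e₁ / c₁ ∧ 2 * e₁ / c₁ ≤ 92160 * f * rb / (ω ^ 2 * δ ^ 2) := by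
  have hω2 : 0 < ω ^ 2 := by positivity
  have hc₁0 : 0 < c₁ := lt_of_lt_of_le (by positivity) hc₁
  have hf0 : 0 ≤ f := by linarith
  constructor
  · rw [div_le_div_iff₀ (by positivity) hc₁0]
    have h1 : 3 * rb * c₁ ≤ 3 * rb * (ω ^ 2 * δ ^ 4 / (2 * rb ^ 5)) :=
      mul_le_mul_of_nonneg_left hc₁' (by positivity)
    have h2 : 2 * (3 * δ ^ 2 / (4 * rb ^ 4)) * (ω ^ 2 * δ ^ 2) ≤ 2 * e₁ * (ω ^ 2 * δ ^ 2) := by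
      gcongr
    have e : 3 * rb * (ω ^ 2 * δ ^ 4 / (2 * rb ^ 5)) =
        2 * (3 * δ ^ 2 / (4 * rb ^ 4)) * (ω ^ 2 * δ ^ 2) := by
      field_simp
      ring
    linarith
  · rw [div_le_div_iff₀ hc₁0 (by positivity)]
    have h1 : 2 * e₁ * (ω ^ 2 * δ ^ 2) ≤ 2 * (360 * f * δ ^ 2 / rb ^ 4) * (ω ^ 2 * δ ^ 2) := by gcongr
    have h2 : 92160 * f * rb * (ω ^ 2 * δ ^ 4 / (128 * rb ^ 5)) ≤ 92160 * f * rb * c₁ :=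
      mul_le_mul_of_nonneg_left hc₁ (by positivity)
    have e : 2 * (360 * f * δ ^ 2 / rb ^ 4) * (ω ^ 2 * δ ^ 2) =
        92160 * f * rb * (ω ^ 2 * δ ^ 4 / (128 * rb ^ 5)) := by
      field_simp
      ring
    linarith

/-- **First largeness condition** with fuzz: if `368640f·r_b ≤ ω²δ³` then `8e₁ ≤ c₁δ`. [folklore] -/
theorem layerBarrier_eight_e₁_le {c₁ e₁ rb : ℝ} (hδ : 0 < δ) (hrb : 0 < rb) (hf : 1 ≤ f)
    (hc₁ : ω ^ 2 * δ ^ 4 / (128 * rb ^ 5) ≤ c₁) (he₁' : e₁ ≤ 360 * f * δ ^ 2 / rb ^ 4)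
    (hbig : 368640 * f * rb ≤ ω ^ 2 * δ ^ 3) : 8 * e₁ ≤ c₁ * δ := by
  have hf0 : 0 ≤ f := by linarith
  have h1 : 8 * e₁ ≤ 8 * (360 * f * δ ^ 2 / rb ^ 4) := by linarith
  have h2 : ω ^ 2 * δ ^ 4 / (128 * rb ^ 5) * δ ≤ c₁ * δ := mul_le_mul_of_nonneg_right hc₁ hδ.le
  have h3 : 8 * (360 * f * δ ^ 2 / rb ^ 4) ≤ ω ^ 2 * δ ^ 4 / (128 * rb ^ 5) * δ := by
    rw [show 8 * (360 * f * δ ^ 2 / rb ^ 4) = 2880 * f * δ ^ 2 / rb ^ 4 by ring,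
      show ω ^ 2 * δ ^ 4 / (128 * rb ^ 5) * δ = ω ^ 2 * δ ^ 5 / (128 * rb ^ 5) by ring,
      div_le_div_iff₀ (by positivity) (by positivity)]
    have := mul_le_mul_of_nonneg_right hbig (show 0 ≤ δ ^ 2 * rb ^ 4 by positivity)
    nlinarith [this]
  linarith

/-- **Second largeness condition** with fuzz: if `2.72·10¹⁸f³ ≤ ω⁴δ³r_b` (`δ ≤ r_b`), then for
`L = 2e₁/c₁`: `(c₂L + e₁ + e₂)·L² ≤ 1`. [folklore] -/
theorem layerBarrier_layer_le_one {c₁ e₁ c₂ e₂ rb L : ℝ} (hω : ω ≠ 0) (hδ : 0 < δ) (hrb : 0 < rb)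
    (hδrb : δ ≤ rb) (hf : 1 ≤ f) (hc₁ : ω ^ 2 * δ ^ 4 / (128 * rb ^ 5) ≤ c₁)
    (hc₁' : c₁ ≤ ω ^ 2 * δ ^ 4 / (2 * rb ^ 5))
    (he₁ : 3 * δ ^ 2 / (4 * rb ^ 4) ≤ e₁) (he₁' : e₁ ≤ 360 * f * δ ^ 2 / rb ^ 4)
    (hc₂' : c₂ ≤ 3456 * ω ^ 2 * δ ^ 3 / rb ^ 4) (he₂' : e₂ ≤ 72 * f * δ ^ 2 / rb ^ 4)
    (hL : L = 2 * e₁ / c₁) (hbig : 2.72e18 * f ^ 3 ≤ ω ^ 4 * δ ^ 3 * rb) :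
    (c₂ * L + e₁ + e₂) * L ^ 2 ≤ 1 := by
  have hω2 : 0 < ω ^ 2 := by positivity
  have hf0 : 0 < f := by linarith
  obtain ⟨hL1, hL2⟩ := layerBarrier_ratio_bounds hω hδ hrb hf hc₁ hc₁' he₁ he₁'
  rw [← hL] at hL1 hL2
  have hL0 : 0 ≤ L := le_trans (by positivity) hL1
  -- `c₂ L + e₁ + e₂ ≤ 3.2·10⁸ f δ/r_b³`
  have hK : c₂ * L + e₁ + e₂ ≤ 3.2e8 * f * δ / rb ^ 3 := by
    have h1 : c₂ * L ≤ 3456 * ω ^ 2 * δ ^ 3 / rb ^ 4 * (92160 * f * rb / (ω ^ 2 * δ ^ 2)) :=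
      mul_le_mul hc₂' hL2 hL0 (by positivity)
    have e1 : 3456 * ω ^ 2 * δ ^ 3 / rb ^ 4 * (92160 * f * rb / (ω ^ 2 * δ ^ 2)) =
        318504960 * f * δ / rb ^ 3 := by field_simp; ring
    have h2 : e₁ + e₂ ≤ 432 * f * δ ^ 2 / rb ^ 4 := by
      have : 360 * f * δ ^ 2 / rb ^ 4 + 72 * f * δ ^ 2 / rb ^ 4 = 432 * f * δ ^ 2 / rb ^ 4 := by ring
      linarith
    have h3 : 432 * f * δ ^ 2 / rb ^ 4 ≤ 432 * f * δ / rb ^ 3 := by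
      rw [div_le_div_iff₀ (by positivity) (by positivity)]
      have := mul_le_mul_of_nonneg_left hδrb (show 0 ≤ 432 * f * δ * rb ^ 3 by positivity)
      nlinarith [this]
    have e2 : 318504960 * f * δ / rb ^ 3 + 432 * f * δ / rb ^ 3 ≤ 3.2e8 * f * δ / rb ^ 3 := by
      rw [← add_div, div_le_div_iff_of_pos_right (by positivity)]
      norm_num
      nlinarith [hf0, hδ]
    linarith
  calc (c₂ * L + e₁ + e₂) * L ^ 2 ≤ 3.2e8 * f * δ / rb ^ 3 * L ^ 2 :=
        mul_le_mul_of_nonneg_right hK (sq_nonneg L)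
    _ ≤ 3.2e8 * f * δ / rb ^ 3 * (92160 * f * rb / (ω ^ 2 * δ ^ 2)) ^ 2 :=
        mul_le_mul_of_nonneg_left (pow_le_pow_left₀ hL0 hL2 2) (by positivity)
    _ = 3.2e8 * 92160 ^ 2 * f ^ 3 / (ω ^ 4 * δ ^ 3 * rb) := by
        field_simp
    _ ≤ 1 := by
        rw [div_le_one (by positivity)]
        norm_num at hbig ⊢
        have : 0 ≤ f ^ 3 := by positivity
        linarith

/-- **Both largeness conditions from the Breitenlohner–Freedman margin and large `Λ′`**, with fuzz:
if `Λ′ ≤ 4ω²r_b²`, `θ₁ r_b ≤ 3δ`, `0 < θ₁ ≤ 1`, `1 ≤ f` and `3.5·10¹⁰f²/θ₁³ ≤ Λ′`, then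
`368640f·r_b ≤ ω²δ³` and `2.72·10¹⁸f³ ≤ ω⁴δ³r_b`. [folklore] -/
theorem layerBarrier_largeness_of_margin {Λ' θ₁ rb : ℝ} (hrb : 0 < rb)
    (hθ₁ : 0 < θ₁) (hθ₁1 : θ₁ ≤ 1) (hf : 1 ≤ f) (hΛω : Λ' ≤ 4 * ω ^ 2 * rb ^ 2)
    (hδθ : θ₁ * rb ≤ 3 * δ) (hΛ : 3.5e10 * f ^ 2 / θ₁ ^ 3 ≤ Λ') :
    368640 * f * rb ≤ ω ^ 2 * δ ^ 3 ∧ 2.72e18 * f ^ 3 ≤ ω ^ 4 * δ ^ 3 * rb := by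
  have hω2 : 0 ≤ ω ^ 2 := sq_nonneg ω
  have hθ3 : 0 < θ₁ ^ 3 := pow_pos hθ₁ 3
  have hf0 : 0 < f := by linarith
  have hδ : 0 < δ := by nlinarith
  have h1 : 3.5e10 * f ^ 2 ≤ Λ' * θ₁ ^ 3 := by rwa [div_le_iff₀ hθ3] at hΛ
  have h2 : θ₁ ^ 3 * rb ^ 3 ≤ 27 * δ ^ 3 := by
    have := pow_le_pow_left₀ (by positivity) hδθ 3
    nlinarith [this]
  have hΛ0 : 0 ≤ Λ' := le_trans (by positivity) hΛ
  have hrb2 : 0 < rb ^ 2 := pow_pos hrb 2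
  have hrb3 : 0 < rb ^ 3 := pow_pos hrb 3
  -- `Λ′θ₁³ r_b ≤ 108 ω²δ³`
  have h3 : Λ' * (θ₁ ^ 3 * rb ^ 3) ≤ 4 * ω ^ 2 * rb ^ 2 * (27 * δ ^ 3) :=
    mul_le_mul hΛω h2 (by positivity) (by positivity)
  have h3' : Λ' * θ₁ ^ 3 * rb * rb ^ 2 ≤ 108 * (ω ^ 2 * δ ^ 3) * rb ^ 2 := by
    calc Λ' * θ₁ ^ 3 * rb * rb ^ 2 = Λ' * (θ₁ ^ 3 * rb ^ 3) := by ring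
      _ ≤ 4 * ω ^ 2 * rb ^ 2 * (27 * δ ^ 3) := h3
      _ = 108 * (ω ^ 2 * δ ^ 3) * rb ^ 2 := by ring
  have h6 : Λ' * θ₁ ^ 3 * rb ≤ 108 * (ω ^ 2 * δ ^ 3) := le_of_mul_le_mul_right h3' hrb2
  constructor
  · have h4 : 3.5e10 * f ^ 2 * rb ≤ Λ' * θ₁ ^ 3 * rb := mul_le_mul_of_nonneg_right h1 hrb.le
    have hff : f ≤ f ^ 2 := by nlinarith
    nlinarith [h6, h4, hff, hrb]
  · -- `Λ′²θ₁³ ≤ 432 ω⁴δ³ r_b` and `Λ′²θ₁³ ≥ 3.5e10 f² · Λ′ ≥ (3.5e10 f²)² /θ₁³ ≥ (3.5e10)² f³`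
    have h4 : Λ' ^ 2 * (θ₁ ^ 3 * rb ^ 3) ≤ (4 * ω ^ 2 * rb ^ 2) ^ 2 * (27 * δ ^ 3) :=
      mul_le_mul (pow_le_pow_left₀ hΛ0 hΛω 2) h2 (by positivity) (by positivity)
    have h4' : Λ' ^ 2 * θ₁ ^ 3 * rb ^ 3 ≤ 432 * (ω ^ 4 * δ ^ 3 * rb) * rb ^ 3 := by
      calc Λ' ^ 2 * θ₁ ^ 3 * rb ^ 3 = Λ' ^ 2 * (θ₁ ^ 3 * rb ^ 3) := by ring
        _ ≤ (4 * ω ^ 2 * rb ^ 2) ^ 2 * (27 * δ ^ 3) := h4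
        _ = 432 * (ω ^ 4 * δ ^ 3 * rb) * rb ^ 3 := by ring
    have h7 : Λ' ^ 2 * θ₁ ^ 3 ≤ 432 * (ω ^ 4 * δ ^ 3 * rb) := le_of_mul_le_mul_right h4' hrb3
    have hΛ1 : 3.5e10 * f ≤ Λ' := by
      have hθ : θ₁ ^ 3 ≤ 1 := pow_le_one₀ hθ₁.le hθ₁1
      have hff : 3.5e10 * f ≤ 3.5e10 * f ^ 2 := by nlinarith
      have : (3.5e10 : ℝ) * f ^ 2 ≤ 3.5e10 * f ^ 2 / θ₁ ^ 3 := by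
        rw [le_div_iff₀ hθ3]; nlinarith
      linarith
    have h5 : 3.5e10 * f * (3.5e10 * f ^ 2) ≤ Λ' ^ 2 * θ₁ ^ 3 := by
      have := mul_le_mul hΛ1 h1 (by positivity) hΛ0
      calc 3.5e10 * f * (3.5e10 * f ^ 2) ≤ Λ' * (Λ' * θ₁ ^ 3) := this
        _ = Λ' ^ 2 * θ₁ ^ 3 := by ring
    have e : 3.5e10 * f * (3.5e10 * f ^ 2) = 1.225e21 * f ^ 3 := by ring
    rw [e] at h5
    norm_num at h5 h7 ⊢
    nlinarith [h5, h7]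

end LayerConstants

end Kerr

end Literature.Geometry.Lorentzian

end
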